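import Mathlib
import Summits.Ventures.PercRepro2.Defs
import Summits.Ventures.PercRepro2.Graph
import Summits.Ventures.PercRepro2.OneColourSwitch
import Summits.Ventures.PercRepro2.RegionHubSign
import Summits.Ventures.PercRepro2.SideSwitch
import Summits.Ventures.PercRepro2.SideSwitchFibre
import Summits.Ventures.PercRepro2.SideSwitchClosed
import Summits.Ventures.PercRepro2.SideSwitchComps
import Summits.Ventures.PercRepro2.SideSwitchCompsFibre
import Summits.Ventures.PercRepro2.TermSwitchDefs
import Summits.Ventures.PercRepro2.TermSwitchFibre
import Summits.Ventures.PercRepro2.TermSwitchCompsFibre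
import Summits.Ventures.PercRepro2.TermSwitchMono
import Summits.Ventures.PercRepro2.TermSwitchM9
import Summits.Ventures.PercRepro2.TermSwitchRestrict
import Summits.Ventures.PercRepro2.TermSwitchReach
import Summits.Ventures.PercRepro2.TermSwitchHalfCube
import Summits.Ventures.PercRepro2.TermSwitchCornerCube
import Summits.Ventures.PercRepro2.TermSwitchCornerCubeSum
import Summits.Ventures.PercRepro2.TermSwitchCornerCubeAll
import Summits.Ventures.PercRepro2.M9NoPocketDefs
import Summits.Ventures.PercRepro2.M9NoPocketWorld
import Summits.Ventures.PercRepro2.M9NoPocketWorldD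
import Summits.Ventures.PercRepro2.M9NoPocketFibre
import Summits.Ventures.PercRepro2.M9PocketUnit
import Summits.Ventures.PercRepro2.M9PocketUnitSum
import Summits.Ventures.PercRepro2.M9PocketUnitPred
import Summits.Ventures.PercRepro2.M9PocketUnitHalf
import Summits.Ventures.PercRepro2.M9PocketUnitCorner

/-!
# The corner-free cube theorem inside a unit, for a SET of `Y`-reached vertices (blind cell
PercRepro2, p3 g38, 2026-08-29; `proofs/P3-POCKETRK.md` §8⁗)

The theorem of `TermSwitchCornerCubeAll` applied to the fibre-invariant predicate «`d` reached,
in the unit of `ρ₀`, and `F (K_H ∪ M_H) (K₂ ∪ M₂ of G − d)`» of `M9PocketUnitPred`: for every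
colouring `ρ₀`, every world-set predicate `F` and every pair of vertex sets `X₀`, `X₁`,
`Σ_{ω ∈ Sep₃ ∩ DZero₃, d reached, ω in the unit of ρ₀, F, ∀ x ∈ X₀, x ∈ K_H(ω),
∃ x ∈ X₁, x ∈ K_H(ω)} σ_pq(ω) ≤ 0` (`dzeroSigmaSumHP_unit_KH_all_exists_nonpos`).  With `X₀`
the vertices of SEVERAL linking free blocks, `X₁` the joined blocks and `F` the predicate `P₁`
of §8″ for their union, this is the inequality `(C3-B″)` of the family (§8⁗).  Own work; std
axioms.
-/
namespace Summit.Ventures.PercRepro2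

namespace NoPocket

open Finset Classical RegionHub OneColourSwitch SideSwitch TermSwitch

variable {V : Type*} {E : Type*}

section Fibre

variable [Fintype V] [DecidableEq V] [Fintype E] [DecidableEq E] {ends : E → Sym2 V}
  {p q r s d : V}

/-- **The corner-free cube theorem inside a unit, for a set `X₀`**: for every `ρ₀`, every
world-set predicate `F` and all vertex sets `X₀`, `X₁`, the sum of `σ_pq` over the `L`-class of the
unit of `ρ₀` restricted by `F`, by «every vertex of `X₀` is in `K_H`» and by «some vertex of `X₁`
is in `K_H`» is non-positive. -/
theorem dzeroSigmaSumHP_unit_KH_all_exists_nonpos (p q : V) (hrd : r ≠ d) (hsd : s ≠ d)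
    (ρ₀ : Config E) (F : Set V → Set V → Prop) (X₀ X₁ : Set V) :
    (∑ ω : Config E, if sepH ends p q ({r, s, d} : Set V) ω ∧ DZeroH ends ({r, s, d} : Set V) ω ∧
      (Reached ends r s d ω ∧
        (∀ e ∈ touches (endsD ends d) (K2 (endsD ends d) r s ω ∪ M2 (endsD ends d) r s ω),
          nu (endsD ends d) r s ω e = ρ₀ e) ∧
        F (KH ends ({r, s, d} : Set V) ω ∪ MH ends ({r, s, d} : Set V) ω)
          (K2 (endsD ends d) r s ω ∪ M2 (endsD ends d) r s ω)) ∧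
      (∀ x ∈ X₀, x ∈ KH ends ({r, s, d} : Set V) ω) ∧
        (∃ x ∈ X₁, x ∈ KH ends ({r, s, d} : Set V) ω) then
        sigma ends ω p q else 0) ≤ 0 := by
  have h := dzeroSigmaSumHP_KH_all_exists_nonpos (ends := ends) p q ({r, s, d} : Set V)
    (fun ω => Reached ends r s d ω ∧
      (∀ e ∈ touches (endsD ends d) (K2 (endsD ends d) r s ω ∪ M2 (endsD ends d) r s ω),
        nu (endsD ends d) r s ω e = ρ₀ e) ∧
      F (KH ends ({r, s, d} : Set V) ω ∪ MH ends ({r, s, d} : Set V) ω)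
        (K2 (endsD ends d) r s ω ∪ M2 (endsD ends d) r s ω))
    (fun _ hρ _ hT => and_congr (reached_assignC_iff hrd hsd hT)
      (and_congr (unit_assignC_iff hrd.symm hsd.symm ρ₀ hρ hT)
        (worldPred_assignC_iff F hrd.symm hsd.symm hρ hT)))
    (fun ρ hρ => and_congr (reached_flipOH_iff ρ)
      (and_congr (unit_flipOH_iff hrd.symm hsd.symm ρ₀ hρ)
        (worldPred_flipOH_iff F hrd.symm hsd.symm ρ)))
    X₀ X₁
  refine le_of_eq_of_le (Finset.sum_congr rfl (fun ω _ => ?_)) h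
  split_ifs <;> rfl

/-- The instance for the predicate `P₁` of the union `C₀` of the linking free blocks, their
vertex set `X₀` and the set `X₁` of the joined blocks: the inequality `(C3-B″)` of §8⁗. -/
theorem dzeroSigmaSumHP_unit_componentTouch_KH_all_exists_nonpos (p q : V) (hrd : r ≠ d)
    (hsd : s ≠ d) (ρ₀ : Config E) (C₀ : Set V) (X₀ X₁ : Set V) :
    (∑ ω : Config E, if sepH ends p q ({r, s, d} : Set V) ω ∧ DZeroH ends ({r, s, d} : Set V) ω ∧
      (Reached ends r s d ω ∧
        (∀ e ∈ touches (endsD ends d) (K2 (endsD ends d) r s ω ∪ M2 (endsD ends d) r s ω),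
          nu (endsD ends d) r s ω e = ρ₀ e) ∧
        ∃ x ∈ C₀, ∃ e, ∃ y, ends e = s(x, y) ∧
          y ∈ KH ends ({r, s, d} : Set V) ω ∪ MH ends ({r, s, d} : Set V) ω ∧
          y ∉ ({r, s, d} : Set V) ∧
          y ∉ K2 (endsD ends d) r s ω ∪ M2 (endsD ends d) r s ω) ∧
      (∀ x ∈ X₀, x ∈ KH ends ({r, s, d} : Set V) ω) ∧
        (∃ x ∈ X₁, x ∈ KH ends ({r, s, d} : Set V) ω) then
        sigma ends ω p q else 0) ≤ 0 := by
  have h := dzeroSigmaSumHP_unit_KH_all_exists_nonpos (ends := ends) p q hrd hsd ρ₀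
    (fun UH U2 => ∃ x ∈ C₀, ∃ e, ∃ y, ends e = s(x, y) ∧ y ∈ UH ∧ y ∉ ({r, s, d} : Set V) ∧
      y ∉ U2) X₀ X₁
  refine le_of_eq_of_le (Finset.sum_congr rfl (fun ω _ => ?_)) h
  split_ifs <;> rfl

end Fibre

end NoPocket

end Summit.Ventures.PercRepro2
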